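import Mathlib.Algebra.Lie.Sl2
import Mathlib.Algebra.Lie.Semisimple.Defs
import Mathlib.Algebra.Module.Torsion.Field
import Mathlib.LinearAlgebra.Eigenspace.Basic
import Mathlib.LinearAlgebra.Dimension.Finite
import Mathlib.LinearAlgebra.FiniteDimensional.Lemmas
import Mathlib.Tactic.IntervalCases
import Mathlib.Tactic.Abel
import Literature.Algebra.Lie.Sl2PartnerUnique
import HarnessLib

/-!
# Lefschetz triples `(𝔤, h, 𝔞)`, Lefschetz pairs and Jordan–Lefschetz pairs (Looijenga–Lunts 1997, §1 and §2)

Topic `Literature/Algebra/Lie` (namespace `Literature.Algebra.Lie`).  Lane `lit-hodgefound` (Track 2 foundations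
library), skeleton seat `lit-hodgefound-skel-1` (generation 38), row **A1-84** of
`run/shared/lean/pub/lit-hodgefound/SKELETON.md`: the ABSTRACT Lie-theoretic notions of Looijenga–Lunts' §1 ("shift, in
Tannakian spirit, the emphasis from modules to Lie algebra's") and §2, of which the lane's concrete records — the total Lie
algebra `(𝔤_tot(X; ℚ), h, H²(X; ℚ))` of a complex torus (rows A1-71 … A1-83) and the Néron–Severi Lie algebra
`(𝔤_NS(X; ℚ), h, NS_ℚ(X))` of an abelian variety (rows A1-54 … A1-70) — are instances (row A1-85 files the instances).
DEFINITIONS WITH BODIES (`adDegree`, `IsSimpleElement`, `lefschetzDomain`, `lefschetzDuals`, `IsLefschetzTriple`,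
`IsLefschetzPair`, `IsLefschetzTriple.IsSaturated`, `IsJordanLefschetzPair`) and PROVED theorems only; Mathlib vocabulary
(`IsSl2Triple`, `LieAlgebra.ad`, `Module.End.eigenspace`, `LieSubalgebra.lieSpan`, `LieAlgebra.IsSemisimple`); no
instance, no local instance attribute, no named fact, no `sorry` (D-0026 net debt `0`).

## Source, VERBATIM

E. Looijenga, V. A. Lunts, *A Lie algebra attached to a projective variety*, Invent. Math. **129** (1997) 361–412
(held text `paper:arxiv-alg-geom_9604014`; page/line numbers of that text):

> (§1, p0003 L106–L111) "We fix a field `K` of characteristic zero. Let `M` be a `ℤ`-graded `K`-vector space of finite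
> dimension and denote by `h : M → M` the transformation that is multiplication by `k` in degree `k`. So a linear
> transformation `u : M → M` has degree `k` if and only if `[h, u] = ku`."
> (p0004 L1–L5, L25–L26) "… this is equivalent to the existence of `K`-linear transformation `f` in `M` of degree `-2`
> such that `[e, f] = h`. This `f` is then unique and `(e, h, f)` is a `𝔰𝔩(2)`-triple […] If `h` and `e` happen to be
> contained in a semisimple Lie subalgebra `𝔤 ⊂ 𝔤𝔩(M)`, then so is `f`."
> (p0004 L28–L37) "Now let `𝔞` be a finite dimensional `K`-vector space. We regard `𝔞` as a graded abelian Lie algebra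
> which is homogeneous of degree two. […] For `a` in this open set, we have defined the operator `f_a` such that
> `(e_a, h, f_a)` is `𝔰𝔩(2)`-triple. This defines a rational map `f : 𝔞 → 𝔤𝔩(M)` […]. We let `𝔤(𝔞, M)` denote the Lie
> subalgebra of `𝔤𝔩(M)` generated by the transformations `e_a, f_a`."
> (p0004 L56–L57) "Notice that `𝔤(𝔞, M)` is evenly graded and that the grading is induced from the action of `ad_h`."
> (§1, p0007 L54–L84) "The preceding suggests to shift, in Tannakian spirit, the emphasis from modules to Lie algebra's.
> For suppose that conversely, we are given a semisimple Lie algebra `𝔤`, a simple element `h ∈ 𝔤` (in the sense of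
> appearing as the middle element of an `𝔰𝔩₂`-triple) and an abelian subalgebra `𝔞` of `𝔤` such that
> **(i)** the adjoint representation of `𝔤` makes `𝔤` a Lefschetz module over `𝔞`, i.e., there is a rational map
> `f : 𝔞 → 𝔤₋₂` so that for `e` in the domain of `f`, we have an `𝔰𝔩(2)`-triple `(e, h, f_e)` and
> **(ii)** `𝔤` is as a Lie algebra generated by `𝔞` and the image of `f`. […] We shall call such a triple a Lefschetz
> triple and its first two items, `(𝔤, h)`, a Lefschetz pair. If we are given a Lefschetz pair `(𝔤, h)`, then we say
> that an associated Lefschetz triple `(𝔤, h, 𝔞)` is saturated if `𝔞` is maximal for this property."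
> (p0007 L91–L93) "(remember that only even values of `k` occur)".
> (§2 (2.1) Proposition, p0009 L83–L92) "Let `M` be a Lefschetz `𝔞`-module. Then the following two properties are
> equivalent (i) The graded Lie algebra `𝔤(𝔞, M)` has degrees `-2`, `0` and `2` only. (ii) The operators `f_a` with
> `a ∈ 𝔞` in the domain of `f`, mutually commute."
> (p0009 L109–L111) "Say that a Lefschetz pair `(𝔤, h)` is a **Jordan–Lefschetz pair** if `(𝔤, h, 𝔤₂)` is a Lefschetz
> triple. It is clear that such a Lefschetz triple is saturated."
> (§2 (2.2) Proposition, p0009 L113–L119) "If `(𝔤, h)` is a Jordan–Lefschetz pair, then `𝔤 = 𝔤₋₂ ⊕ 𝔤₀ ⊕ 𝔤₂` and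
> `U𝔤 = U𝔤₂.U𝔤₀.U𝔤₋₂`.  Proof. If `e ∈ 𝔤₂` is a Lefschetz element, then `[e, 𝔤₂] = 0`. The first assertion now follows
> from the primitive decomposition under `ad_e`."

## Rendering (dictionary)

* `𝔤` = a Lie algebra `L` over `K` (Mathlib `LieRing L`, `LieAlgebra K L`); "`𝔤_k`" = `adDegree K h k`, the eigenspace of
  `ad h` for the eigenvalue `k` ("`u` has degree `k` if and only if `[h, u] = ku`"), indexed by `k : K`.
* "simple element `h`" = `IsSimpleElement h`: `h` is the middle of an `𝔰𝔩₂`-triple `(e, h, f)` in `L` (Mathlib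
  `IsSl2Triple h e f`: `[e, f] = h`, `[h, e] = 2e`, `[h, f] = -2f`, `h ≠ 0`).
* "abelian subalgebra `𝔞`", "homogeneous of degree two" = a `K`-subspace `𝔞 ≤ 𝔤₂` with `[𝔞, 𝔞] = 0` (the fields
  `le_adDegree_two`, `lie_eq_zero` of `IsLefschetzTriple`).
* "the domain of `f`" = `lefschetzDomain K h 𝔞 = {e ∈ 𝔞 | ∃ f, (e, h, f) is an 𝔰𝔩₂-triple in L}` (for semisimple `L`
  the partner `f ∈ 𝔤𝔩(𝔤)` furnished by Jacobson–Morozov lies in `ad(𝔤)`: "If `h` and `e` happen to be contained in a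
  semisimple Lie subalgebra … then so is `f`"); "the image of `f`" = `lefschetzDuals K h 𝔞 = {f | ∃ e ∈ 𝔞, (e, h, f)}`;
  **(i)** = the domain of `f` is non-empty ("for some `a ∈ 𝔞`, `e_a` has that property"); **(ii)** =
  `LieSubalgebra.lieSpan K L (𝔞 ∪ image of f) = ⊤`.
* "semisimple" = Mathlib `LieAlgebra.IsSemisimple K L`.

## Contents (all proved)

* §1 `adDegree`: `mem_adDegree_iff`, **`lie_mem_adDegree`** (`[𝔤_a, 𝔤_b] ⊆ 𝔤_{a+b}`, Jacobi), `self_mem_adDegree_zero`,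
  the degrees `2, 0, -2` of an `𝔰𝔩₂`-triple, `iterate_mem_adDegree` (`(ad x)^n 𝔤_c ⊆ 𝔤_{c + n a}`), `disjoint_adDegree`,
  `lie_mem_iSup_adDegree` / `lieSpan_le_iSup_adDegree` (a family of degrees closed under the brackets that occur spans a
  Lie subalgebra containing the Lie algebra generated by its elements).
* §2 `IsSimpleElement`, `lefschetzDomain`, `lefschetzDuals` (`⊆ 𝔤₋₂`), uniqueness of `f_e`
  (`eq_of_isSl2Triple_of_isSl2Triple`, `existsUnique_of_mem_lefschetzDomain`, from the tree's `f_eq_of_isSl2Triple`).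
* §3 **`IsLefschetzTriple K h 𝔞`**, `IsLefschetzPair K h`, `IsLefschetzTriple.IsSaturated`; API: `isSimpleElement`,
  `h_ne_zero`, `lefschetzDuals_subset`, **`iSup_adDegree_even_eq_top`** ("only even values of `k` occur":
  `𝔤 = Σ_k 𝔤_{2k}`), `isLefschetzPair`.
* §4 **`IsJordanLefschetzPair K h`** `:= IsLefschetzTriple K h 𝔤₂`; `isSaturated` ("It is clear that such a Lefschetz
  triple is saturated"); **(2.2) Proposition, first assertion: `adDegree_eq_bot` (`𝔤_c = 0` for `c ∉ {-2, 0, 2}`) and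
  `sup_adDegree_eq_top` (`𝔤 = 𝔤₋₂ ⊕ 𝔤₀ ⊕ 𝔤₂`, with `disjoint_adDegree` for directness)** over a field of characteristic
  `0`, `𝔤` finite-dimensional; (2.1) (i) ⇒ (ii) for Jordan–Lefschetz pairs: **`lie_eq_zero_of_mem_adDegree_neg_two`**
  (`𝔤₋₂` is abelian, so the `f_e` mutually commute, `lie_eq_zero_of_mem_lefschetzDuals`).
* §5 Validation: **`isJordanLefschetzPair_of_isSl2Triple`** — `𝔰𝔩₂` itself: if `L` is semisimple and spanned by an
  `𝔰𝔩₂`-triple `(e, h, f)`, then `(L, h)` is a Jordan–Lefschetz pair with `𝔤₂ = K e` (the case `(A₁, ∅)`, `m = 1`, of the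
  classification (2.6)).
* §6 `𝔰𝔩₂` continued: `mem_adDegree_zero_iff_of_isSl2Triple` / `mem_adDegree_neg_two_iff_of_isSl2Triple` (`𝔤₀ = K h`,
  `𝔤₋₂ = K f`), `adDegree_eq_bot_of_isSl2Triple` (no other degree occurs), `finrank_eq_three_of_isSl2Triple` (`dim = 3`),
  and conversely `exists_eq_smul_add_of_isSl2Triple` / **`isJordanLefschetzPair_of_isSl2Triple_of_finrank_eq_three`** (a
  semisimple `3`-dimensional `L` with an `𝔰𝔩₂`-triple `(e, h, f)` is spanned by it, so `(L, h)` is a Jordan–Lefschetz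
  pair) — the form used for the elliptic curve (`𝔤_tot(X; ℚ) ≅ 𝔰𝔩₂(ℚ)`, `dim = 3`).

## Proof of (2.2) (where it is not the printed one)

Printed: "If `e ∈ 𝔤₂` is a Lefschetz element, then `[e, 𝔤₂] = 0`. The first assertion now follows from the primitive
decomposition under `ad_e`."  Here, without the primitive decomposition (Mathlib has no complete reducibility for
`𝔰𝔩₂`): (a) the subspace `W = Σ_{k ≤ 1} 𝔤_{2k}` is closed under brackets BECAUSE `[𝔤₂, 𝔤₂] = 0` (all other brackets land
in degrees `≤ 2`), and it contains the generators `𝔤₂` and `f(dom f) ⊆ 𝔤₋₂`, so `W = 𝔤` by (ii) — whence `𝔤` is graded by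
`ad h` with even degrees `≤ 2` (eigenspaces for distinct eigenvalues being independent); (b) if `x ≠ 0` had degree
`2k ≤ -4`, push it down by `ad f` (`(e, h, f)` an `𝔰𝔩₂`-triple from (i)) to a lowest-weight vector `y ≠ 0`, `[f, y] = 0`, of
degree `-m`, `m ≥ 4`; for the opposite triple `(f, -h, e)` this is a primitive vector of weight `m ∈ ℕ`, so
`(ad e)^m y ≠ 0` (Mathlib `IsSl2Triple.HasPrimitiveVectorWith.pow_toEnd_f_ne_zero_of_eq_nat`) — an element of degree
`m ≥ 4`, contradicting (a).

## SCOPE (what is NOT formalised here)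

(a) Lefschetz MODULES `(𝔞, M)`, the Lie algebra `𝔤(𝔞, M) ⊆ 𝔤𝔩(M)` and the Lefschetz property `e^k : M_{-k} ≅ M_k` (§1
(1.1)–(1.6)) are not introduced abstractly: the lane's records carry them concretely (`Geometry/Kaehler/ComplexTorusTotalLieAlgebra`:
`totalLieAlgebra`, `llAlgebra`, `isSl2Triple_iff`; `AlgebraicGeometry/Hyperkaehler/LooijengaLuntsVerbitsky`: `llvAlgebra`,
`IsDualLefschetz`); the equivalence "Lefschetz property ⟺ Jacobson–Morozov partner" is not restated.  (b) "rational map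
`f : 𝔞 → 𝔤₋₂`" is rendered by its domain and image as SETS (no algebraic-geometry structure on `𝔞`; "Zariski open" is
not formalised).  (c) Of (2.1) only (i) ⇒ (ii) (in the Jordan–Lefschetz setting); of (2.2) only the first assertion
(`U𝔤 = U𝔤₂.U𝔤₀.U𝔤₋₂` is not formalised); (2.3)–(2.9) (primitive generation, the classification, Jordan–Lefschetz
modules) are not formalised.  (d) Nothing in this file concerns complex tori or the Hodge conjecture.

## References

* [LooijengaLunts1997] E. Looijenga, V. A. Lunts, *A Lie algebra attached to a projective variety*, Invent. Math. 129
  (1997) 361–412; arXiv:alg-geom/9604014. §1 (1.1) (pp. 3–4), Lefschetz triples (p. 7); §2 (2.1), (2.2) (p. 9) (held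
  `paper:arxiv-alg-geom_9604014`, p0003–p0004, p0007, p0009).
-/

namespace Literature.Algebra.Lie

open Module Function Set

/-! ### §1 The grading of `𝔤` by `ad h`: `𝔤_k = {u | [h, u] = k u}` -/

section Grading

variable (K : Type*) {L : Type*} [CommRing K] [LieRing L] [LieAlgebra K L]

/-- **`𝔤_k`, the degree-`k` part of `𝔤` with respect to `h`**: "a linear transformation `u` has degree `k` if and only
if `[h, u] = ku`" — the eigenspace of `ad h` for the eigenvalue `k` (a `K`-subspace of `L`; the degree is indexed by
`k : K`). [cite: LooijengaLunts1997, §1 (1.1) p. 3 ("u has degree k if and only if [h,u] = ku"), p. 4 ("the grading is induced from the action of ad_h")] -/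
def adDegree (h : L) (k : K) : Submodule K L := Module.End.eigenspace (LieAlgebra.ad K L h) k

variable {K}

/-- `u ∈ 𝔤_k ↔ [h, u] = k • u`. [cite: LooijengaLunts1997, §1 (1.1) p. 3] -/
theorem mem_adDegree_iff {h u : L} {k : K} : u ∈ adDegree K h k ↔ ⁅h, u⁆ = k • u := by
  rw [adDegree, Module.End.mem_eigenspace_iff, LieAlgebra.ad_apply]

/-- **`[𝔤_a, 𝔤_b] ⊆ 𝔤_{a+b}`** (the Jacobi identity: `[h, [x, y]] = [[h, x], y] + [x, [h, y]]`). [cite: LooijengaLunts1997, §1 (1.1) p. 4 ("𝔤(𝔞, M) is evenly graded and … the grading is induced from the action of ad_h")] -/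
theorem lie_mem_adDegree {h x y : L} {a b : K} (hx : x ∈ adDegree K h a) (hy : y ∈ adDegree K h b) :
    ⁅x, y⁆ ∈ adDegree K h (a + b) := by
  rw [mem_adDegree_iff] at hx hy ⊢
  rw [leibniz_lie, hx, hy, smul_lie, lie_smul, add_smul]

/-- `h ∈ 𝔤₀` (`[h, h] = 0`). [cite: LooijengaLunts1997, §1 p. 7 ("then 𝔥 ⊂ 𝔤₀")] -/
theorem self_mem_adDegree_zero (h : L) : h ∈ adDegree K h 0 := by
  rw [mem_adDegree_iff, lie_self, zero_smul]

/-- In an `𝔰𝔩₂`-triple `(e, h, f)`, `e ∈ 𝔤₂`. [cite: LooijengaLunts1997, §1 (1.1) p. 4] -/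
theorem e_mem_adDegree {h e f : L} (t : IsSl2Triple h e f) : e ∈ adDegree K h 2 := by
  rw [mem_adDegree_iff, t.lie_h_e_smul K]

/-- In an `𝔰𝔩₂`-triple `(e, h, f)`, `f ∈ 𝔤₋₂` ("`f` … of degree `-2`"). [cite: LooijengaLunts1997, §1 (1.1) p. 4] -/
theorem f_mem_adDegree {h e f : L} (t : IsSl2Triple h e f) : f ∈ adDegree K h (-2) := by
  rw [mem_adDegree_iff, t.lie_lie_smul_f K, neg_smul]

/-- `[𝔤₂, 𝔤₋₂] ⊆ 𝔤₀`, `[𝔤₀, 𝔤_{±2}] ⊆ 𝔤_{±2}`, `[𝔤₀, 𝔤₀] ⊆ 𝔤₀`: the bracket relations among the degrees `-2, 0, 2`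
(instances of `lie_mem_adDegree`). [cite: LooijengaLunts1997, §2 (2.2), (2.5) p. 9] -/
theorem lie_mem_adDegree_relations (h : L) :
    (∀ x ∈ adDegree K h 2, ∀ y ∈ adDegree K h (-2), ⁅x, y⁆ ∈ adDegree K h 0) ∧
      (∀ x ∈ adDegree K h 0, ∀ y ∈ adDegree K h 2, ⁅x, y⁆ ∈ adDegree K h 2) ∧
      (∀ x ∈ adDegree K h 0, ∀ y ∈ adDegree K h (-2), ⁅x, y⁆ ∈ adDegree K h (-2)) ∧
      (∀ x ∈ adDegree K h 0, ∀ y ∈ adDegree K h 0, ⁅x, y⁆ ∈ adDegree K h 0) := by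
  refine ⟨fun x hx y hy ↦ ?_, fun x hx y hy ↦ ?_, fun x hx y hy ↦ ?_, fun x hx y hy ↦ ?_⟩
  · simpa using lie_mem_adDegree hx hy
  · simpa using lie_mem_adDegree hx hy
  · simpa using lie_mem_adDegree hx hy
  · simpa using lie_mem_adDegree hx hy

/-- `(ad x)^n` maps `𝔤_c` into `𝔤_{c + n a}` for `x ∈ 𝔤_a`. [cite: LooijengaLunts1997, §1 (1.1)] -/
theorem iterate_mem_adDegree {h x : L} {a c : K} (hx : x ∈ adDegree K h a) (n : ℕ) {u : L}
    (hu : u ∈ adDegree K h c) : ((LieAlgebra.ad K L x) ^ n) u ∈ adDegree K h (c + n * a) := by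
  induction n with
  | zero => simpa using hu
  | succ n ih =>
    rw [pow_succ', Module.End.mul_apply, LieAlgebra.ad_apply, Nat.cast_succ, add_mul, one_mul, ← add_assoc,
      add_comm (c + n * a) a]
    exact lie_mem_adDegree hx ih

/-- **A family of degrees closed under the brackets that occur spans a bracket-closed subspace**: if for all `i, j`
the bracket `[𝔤_{d i}, 𝔤_{d j}]` lies in `Σ_i 𝔤_{d i}`, then so does `[x, y]` for all `x, y ∈ Σ_i 𝔤_{d i}`. [cite: LooijengaLunts1997, §1 (1.1) p. 4 ("evenly graded"), §2 proof of (2.2)] -/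
theorem lie_mem_iSup_adDegree {ι : Type*} {h : L} {d : ι → K}
    (hd : ∀ i j, ∀ x ∈ adDegree K h (d i), ∀ y ∈ adDegree K h (d j), ⁅x, y⁆ ∈ ⨆ i, adDegree K h (d i))
    {x y : L} (hx : x ∈ ⨆ i, adDegree K h (d i)) (hy : y ∈ ⨆ i, adDegree K h (d i)) :
    ⁅x, y⁆ ∈ ⨆ i, adDegree K h (d i) := by
  refine Submodule.iSup_induction (fun i ↦ adDegree K h (d i)) (motive := fun x ↦ ⁅x, y⁆ ∈ ⨆ i, adDegree K h (d i))
    hx (fun i x hx ↦ ?_) (by rw [zero_lie]; exact Submodule.zero_mem _) (fun x x' hx hx' ↦ by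
      rw [add_lie]; exact Submodule.add_mem _ hx hx')
  exact Submodule.iSup_induction (fun i ↦ adDegree K h (d i)) (motive := fun y ↦ ⁅x, y⁆ ∈ ⨆ i, adDegree K h (d i))
    hy (fun j y hy ↦ hd i j x hx y hy) (by rw [lie_zero]; exact Submodule.zero_mem _) (fun y y' hy hy' ↦ by
      rw [lie_add]; exact Submodule.add_mem _ hy hy')

/-- The bracket-closed subspace `Σ_i 𝔤_{d i}` of `lie_mem_iSup_adDegree` as a Lie subalgebra. [cite: LooijengaLunts1997, §1 (1.1) p. 4] -/
def iSupAdDegreeLieSubalgebra {ι : Type*} (h : L) (d : ι → K)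
    (hd : ∀ i j, ∀ x ∈ adDegree K h (d i), ∀ y ∈ adDegree K h (d j), ⁅x, y⁆ ∈ ⨆ i, adDegree K h (d i)) :
    LieSubalgebra K L :=
  { (⨆ i, adDegree K h (d i) : Submodule K L) with
    lie_mem' := fun hx hy ↦ lie_mem_iSup_adDegree hd hx hy }

/-- Its underlying subspace is `Σ_i 𝔤_{d i}`. [cite: LooijengaLunts1997, §1 (1.1) p. 4] -/
theorem mem_iSupAdDegreeLieSubalgebra_iff {ι : Type*} {h : L} {d : ι → K}
    (hd : ∀ i j, ∀ x ∈ adDegree K h (d i), ∀ y ∈ adDegree K h (d j), ⁅x, y⁆ ∈ ⨆ i, adDegree K h (d i)) {x : L} :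
    x ∈ iSupAdDegreeLieSubalgebra h d hd ↔ x ∈ ⨆ i, adDegree K h (d i) := Iff.rfl

/-- **The Lie algebra generated by elements of `Σ_i 𝔤_{d i}` stays inside `Σ_i 𝔤_{d i}`** when that subspace is
bracket-closed. [cite: LooijengaLunts1997, §1 (1.1) p. 4 ("𝔤(𝔞, M) is evenly graded")] -/
theorem lieSpan_le_iSup_adDegree {ι : Type*} {h : L} {d : ι → K}
    (hd : ∀ i j, ∀ x ∈ adDegree K h (d i), ∀ y ∈ adDegree K h (d j), ⁅x, y⁆ ∈ ⨆ i, adDegree K h (d i))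
    {s : Set L} (hs : ∀ x ∈ s, x ∈ ⨆ i, adDegree K h (d i)) {x : L} (hx : x ∈ LieSubalgebra.lieSpan K L s) :
    x ∈ ⨆ i, adDegree K h (d i) :=
  (LieSubalgebra.lieSpan_le (K := iSupAdDegreeLieSubalgebra h d hd)).2 hs hx

end Grading

section GradingField

variable {K : Type*} {L : Type*} [Field K] [LieRing L] [LieAlgebra K L]

/-- **Distinct degrees are independent: `𝔤_a ∩ 𝔤_b = 0` for `a ≠ b`** (eigenspaces of `ad h` for distinct eigenvalues).
[cite: LooijengaLunts1997, §2 (2.2) ("𝔤 = 𝔤₋₂ ⊕ 𝔤₀ ⊕ 𝔤₂")] -/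
theorem disjoint_adDegree (h : L) {a b : K} (hab : a ≠ b) : Disjoint (adDegree K h a) (adDegree K h b) :=
  (Module.End.eigenspaces_iSupIndep (LieAlgebra.ad K L h)).pairwiseDisjoint hab

/-- **`𝔤_c` meets a sum of OTHER degrees trivially**: if `c ∉ d(ι)` then `𝔤_c ∩ Σ_i 𝔤_{d i} = 0`.
[cite: LooijengaLunts1997, §2 (2.2)] -/
theorem disjoint_adDegree_iSup {ι : Type*} (h : L) {d : ι → K} {c : K} (hc : ∀ i, d i ≠ c) :
    Disjoint (adDegree K h c) (⨆ i, adDegree K h (d i)) := by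
  have h1 := (Module.End.eigenspaces_iSupIndep (LieAlgebra.ad K L h)).disjoint_biSup
    (y := Set.range d) (x := c) (by rintro ⟨i, hi⟩; exact hc i hi)
  refine h1.mono_right (iSup_le fun i ↦ ?_)
  exact le_iSup₂_of_le (f := fun μ (_ : μ ∈ Set.range d) ↦ Module.End.eigenspace (LieAlgebra.ad K L h) μ) (d i)
    (Set.mem_range_self i) le_rfl

/-- If `𝔤 = Σ_i 𝔤_{d i}` then every degree outside `d(ι)` vanishes. [cite: LooijengaLunts1997, §2 (2.2)] -/
theorem adDegree_eq_bot_of_iSup_eq_top {ι : Type*} (h : L) {d : ι → K} (htop : ⨆ i, adDegree K h (d i) = ⊤) {c : K}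
    (hc : ∀ i, d i ≠ c) : adDegree K h c = ⊥ := by
  have h1 := disjoint_adDegree_iSup h hc
  rw [htop, disjoint_top] at h1
  exact h1

/-- Directness of `𝔤₋₂ ⊕ 𝔤₀ ⊕ 𝔤₂`: `(𝔤₋₂ + 𝔤₀) ∩ 𝔤₂ = 0` (and `𝔤₋₂ ∩ 𝔤₀ = 0`, `disjoint_adDegree`) — eigenspaces of `ad h`
for distinct eigenvalues, in characteristic `0`. [cite: LooijengaLunts1997, §2 (2.2) p. 9] -/
theorem disjoint_sup_adDegree [CharZero K] (h : L) :
    Disjoint (adDegree K h (-2) ⊔ adDegree K h 0) (adDegree K h 2) := by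
  have h1 := disjoint_adDegree_iSup h (d := fun b : Bool ↦ cond b (-2 : K) 0) (c := 2)
    (by rintro (_ | _) <;> norm_num)
  rw [disjoint_comm]
  refine h1.mono_right (sup_le ?_ ?_)
  · exact le_iSup_of_le true le_rfl
  · exact le_iSup_of_le false le_rfl

end GradingField

/-! ### §2 Simple elements; the domain and the image of `f` -/

section Domain

variable (K : Type*) {L : Type*} [CommRing K] [LieRing L] [LieAlgebra K L]

/-- **A simple element `h ∈ 𝔤`** "(in the sense of appearing as the middle element of an `𝔰𝔩₂`-triple)".
[cite: LooijengaLunts1997, §1 p. 7 L56–L57] -/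
def IsSimpleElement (h : L) : Prop := ∃ e f : L, IsSl2Triple h e f

-- (`IsSimpleElement h` does not depend on the scalars `K`: an `𝔰𝔩₂`-triple is a notion of the Lie ring `L`.)

/-- **The domain of `f`** on `𝔞`: the elements `e ∈ 𝔞` that are the first member of an `𝔰𝔩₂`-triple `(e, h, f_e)` in `𝔤`
(the Lefschetz elements of `𝔞`; "for `e` in the domain of `f`, we have an `𝔰𝔩(2)`-triple `(e, h, f_e)`").
[cite: LooijengaLunts1997, §1 (1.1) p. 4 L31–L35, p. 7 L62–L64] -/
def lefschetzDomain (h : L) (𝔞 : Submodule K L) : Set L := {e | e ∈ 𝔞 ∧ ∃ f : L, IsSl2Triple h e f}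

/-- **The image of `f`**: the partners `f_e` of the Lefschetz elements `e ∈ 𝔞` ("the image of `f`").
[cite: LooijengaLunts1997, §1 p. 7 L66 ("𝔤 is as a Lie algebra generated by 𝔞 and the image of f")] -/
def lefschetzDuals (h : L) (𝔞 : Submodule K L) : Set L := {f | ∃ e ∈ 𝔞, IsSl2Triple h e f}

variable {K}

/-- Membership in the domain of `f`. [cite: LooijengaLunts1997, §1 p. 7] -/
theorem mem_lefschetzDomain_iff {h : L} {𝔞 : Submodule K L} {e : L} :
    e ∈ lefschetzDomain K h 𝔞 ↔ e ∈ 𝔞 ∧ ∃ f : L, IsSl2Triple h e f := Iff.rfl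

/-- Membership in the image of `f`. [cite: LooijengaLunts1997, §1 p. 7] -/
theorem mem_lefschetzDuals_iff {h : L} {𝔞 : Submodule K L} {f : L} :
    f ∈ lefschetzDuals K h 𝔞 ↔ ∃ e ∈ 𝔞, IsSl2Triple h e f := Iff.rfl

/-- The domain of `f` lies in `𝔞`. [cite: LooijengaLunts1997, §1 p. 7] -/
theorem lefschetzDomain_subset {h : L} {𝔞 : Submodule K L} : lefschetzDomain K h 𝔞 ⊆ 𝔞 := fun _ he ↦ he.1

/-- `f_e` lies in the image of `f` and `e` in its domain. [cite: LooijengaLunts1997, §1 p. 7] -/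
theorem mem_lefschetzDuals_of_isSl2Triple {h e f : L} {𝔞 : Submodule K L} (he : e ∈ 𝔞) (t : IsSl2Triple h e f) :
    e ∈ lefschetzDomain K h 𝔞 ∧ f ∈ lefschetzDuals K h 𝔞 := ⟨⟨he, f, t⟩, e, he, t⟩

/-- **The image of `f` lies in `𝔤₋₂`** ("a rational map `f : 𝔞 → 𝔤₋₂`"). [cite: LooijengaLunts1997, §1 p. 7 L62] -/
theorem lefschetzDuals_subset_adDegree {h : L} {𝔞 : Submodule K L} : lefschetzDuals K h 𝔞 ⊆ adDegree K h (-2) := by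
  rintro f ⟨e, -, t⟩
  exact (f_mem_adDegree t)

/-- A non-empty domain of `f` makes `h` a simple element. [cite: LooijengaLunts1997, §1 p. 7] -/
theorem isSimpleElement_of_mem_lefschetzDomain {h e : L} {𝔞 : Submodule K L} (he : e ∈ lefschetzDomain K h 𝔞) :
    IsSimpleElement h := by
  obtain ⟨-, f, t⟩ := he
  exact ⟨e, f, t⟩

end Domain

section DomainField

/-- **"This `f` is then unique"**: two `𝔰𝔩₂`-triples `(e, h, f)`, `(e, h, f')` of a finite-dimensional Lie algebra in
characteristic `0` have `f = f'` (the tree's `f_eq_of_isSl2Triple`), so `e ↦ f_e` is a well-defined partial map on the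
domain of `f`. [cite: LooijengaLunts1997, §1 (1.1) p. 4 L4 ("This f is then unique")] -/
theorem eq_of_isSl2Triple_of_isSl2Triple (K : Type*) {L : Type*} [Field K] [CharZero K] [LieRing L] [LieAlgebra K L]
    [FiniteDimensional K L] {h e f f' : L} (t : IsSl2Triple h e f) (t' : IsSl2Triple h e f') : f = f' :=
  f_eq_of_isSl2Triple (R := K) t t'

variable {K : Type*} {L : Type*} [Field K] [CharZero K] [LieRing L] [LieAlgebra K L] [FiniteDimensional K L]

/-- Each Lefschetz element `e` of `𝔞` has EXACTLY ONE partner in the image of `f`. [cite: LooijengaLunts1997, §1 (1.1) p. 4 L4, p. 7] -/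
theorem existsUnique_of_mem_lefschetzDomain {h e : L} {𝔞 : Submodule K L} (he : e ∈ lefschetzDomain K h 𝔞) :
    ∃! f : L, IsSl2Triple h e f := by
  obtain ⟨-, f, t⟩ := he
  exact ⟨f, t, fun f' t' ↦ eq_of_isSl2Triple_of_isSl2Triple K t' t⟩

end DomainField

/-! ### §3 Lefschetz triples `(𝔤, h, 𝔞)` and Lefschetz pairs `(𝔤, h)` -/

section Triple

variable (K : Type*) {L : Type*} [CommRing K] [LieRing L] [LieAlgebra K L]

/-- **A Lefschetz triple `(𝔤, h, 𝔞)`**: "a semisimple Lie algebra `𝔤`, a simple element `h ∈ 𝔤` […] and an abelian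
subalgebra `𝔞` of `𝔤`" — homogeneous of degree two — "such that (i) […] there is a rational map `f : 𝔞 → 𝔤₋₂` so that
for `e` in the domain of `f`, we have an `𝔰𝔩(2)`-triple `(e, h, f_e)` and (ii) `𝔤` is as a Lie algebra generated by `𝔞`
and the image of `f`".  Rendered on a `K`-subspace `𝔞` of the Lie algebra `L`: `L` semisimple; `𝔞 ≤ 𝔤₂`; `[𝔞, 𝔞] = 0`;
(i) the domain of `f` on `𝔞` is non-empty (so `h` is simple, `isSimpleElement`); (ii) the Lie subalgebra generated by
`𝔞` and the image of `f` is all of `L`. [cite: LooijengaLunts1997, §1 p. 7 L54–L78 (Lefschetz triple)] -/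
structure IsLefschetzTriple (h : L) (𝔞 : Submodule K L) : Prop where
  /-- "a semisimple Lie algebra `𝔤`" -/
  isSemisimple : LieAlgebra.IsSemisimple K L
  /-- "`𝔞` … homogeneous of degree two": `𝔞 ⊆ 𝔤₂` -/
  le_adDegree_two : 𝔞 ≤ adDegree K h 2
  /-- "an abelian subalgebra `𝔞`": `[𝔞, 𝔞] = 0` -/
  lie_eq_zero : ∀ a ∈ 𝔞, ∀ b ∈ 𝔞, ⁅a, b⁆ = 0
  /-- (i) "for `e` in the domain of `f`, we have an `𝔰𝔩(2)`-triple `(e, h, f_e)`" — and the domain is non-empty -/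
  nonempty_lefschetzDomain : (lefschetzDomain K h 𝔞).Nonempty
  /-- (ii) "`𝔤` is as a Lie algebra generated by `𝔞` and the image of `f`" -/
  lieSpan_eq_top : LieSubalgebra.lieSpan K L ((𝔞 : Set L) ∪ lefschetzDuals K h 𝔞) = ⊤

/-- **A Lefschetz pair `(𝔤, h)`**: the first two items of some Lefschetz triple `(𝔤, h, 𝔞)`.
[cite: LooijengaLunts1997, §1 p. 7 L77–L78 ("its first two items, (𝔤, h), a Lefschetz pair")] -/
def IsLefschetzPair (h : L) : Prop := ∃ 𝔞 : Submodule K L, IsLefschetzTriple K h 𝔞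

/-- **A saturated Lefschetz triple**: "an associated Lefschetz triple `(𝔤, h, 𝔞)` is saturated if `𝔞` is maximal for this
property". [cite: LooijengaLunts1997, §1 p. 7 L78–L82] -/
def IsLefschetzTriple.IsSaturated {h : L} {𝔞 : Submodule K L} (_ : IsLefschetzTriple K h 𝔞) : Prop :=
  ∀ 𝔞' : Submodule K L, 𝔞 ≤ 𝔞' → IsLefschetzTriple K h 𝔞' → 𝔞' = 𝔞

variable {K} {h : L} {𝔞 : Submodule K L}

namespace IsLefschetzTriple

/-- In a Lefschetz triple, `h` is a simple element. [cite: LooijengaLunts1997, §1 p. 7 L56] -/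
theorem isSimpleElement (T : IsLefschetzTriple K h 𝔞) : IsSimpleElement h := by
  obtain ⟨e, he⟩ := T.nonempty_lefschetzDomain
  exact isSimpleElement_of_mem_lefschetzDomain he

/-- In a Lefschetz triple, `h ≠ 0`. [cite: LooijengaLunts1997, §1 p. 7] -/
theorem h_ne_zero (T : IsLefschetzTriple K h 𝔞) : h ≠ 0 := by
  obtain ⟨e, f, t⟩ := T.isSimpleElement
  exact t.h_ne_zero

/-- In a Lefschetz triple, `L ≠ 0`. [cite: LooijengaLunts1997, §1 p. 7] -/
theorem nontrivial (T : IsLefschetzTriple K h 𝔞) : Nontrivial L := ⟨⟨h, 0, T.h_ne_zero⟩⟩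

/-- `(𝔤, h)` is a Lefschetz pair. [cite: LooijengaLunts1997, §1 p. 7 L77–L78] -/
theorem isLefschetzPair (T : IsLefschetzTriple K h 𝔞) : IsLefschetzPair K h := ⟨𝔞, T⟩

/-- The image of `f` lies in `𝔤₋₂`. [cite: LooijengaLunts1997, §1 p. 7 L62 ("a rational map f : 𝔞 → 𝔤₋₂")] -/
theorem lefschetzDuals_subset (_T : IsLefschetzTriple K h 𝔞) : lefschetzDuals K h 𝔞 ⊆ adDegree K h (-2) :=
  lefschetzDuals_subset_adDegree

/-- The generators `𝔞 ∪ f(dom f)` lie in the even degrees `𝔤₂`, `𝔤₋₂`. [cite: LooijengaLunts1997, §1 p. 7] -/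
theorem generators_subset_iSup_even (T : IsLefschetzTriple K h 𝔞) :
    ∀ x ∈ ((𝔞 : Set L) ∪ lefschetzDuals K h 𝔞), x ∈ ⨆ k : ℤ, adDegree K h (2 * (k : K)) := by
  rintro x (hx | hx)
  · have h1 : x ∈ adDegree K h (2 * ((1 : ℤ) : K)) := by rw [Int.cast_one, mul_one]; exact T.le_adDegree_two hx
    exact Submodule.mem_iSup_of_mem (1 : ℤ) h1
  · have h1 : x ∈ adDegree K h (2 * ((-1 : ℤ) : K)) := by
      rw [Int.cast_neg, Int.cast_one, mul_neg, mul_one]; exact T.lefschetzDuals_subset hx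
    exact Submodule.mem_iSup_of_mem (-1 : ℤ) h1

/-- **"only even values of `k` occur": a Lefschetz triple is evenly graded, `𝔤 = Σ_{k ∈ ℤ} 𝔤_{2k}`** — the generators have
degrees `±2` and `[𝔤_{2i}, 𝔤_{2j}] ⊆ 𝔤_{2(i+j)}`. [cite: LooijengaLunts1997, §1 (1.1) p. 4 L56 ("𝔤(𝔞, M) is evenly graded"), p. 7 L93 ("only even values of k occur")] -/
theorem iSup_adDegree_even_eq_top (T : IsLefschetzTriple K h 𝔞) : ⨆ k : ℤ, adDegree K h (2 * (k : K)) = ⊤ := by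
  refine eq_top_iff.2 fun x _ ↦ ?_
  have hx : x ∈ LieSubalgebra.lieSpan K L ((𝔞 : Set L) ∪ lefschetzDuals K h 𝔞) := by
    rw [T.lieSpan_eq_top]; exact LieSubalgebra.mem_top x
  refine lieSpan_le_iSup_adDegree (fun i j x hx y hy ↦ ?_) T.generators_subset_iSup_even hx
  have h1 := lie_mem_adDegree hx hy
  rw [← mul_add, ← Int.cast_add] at h1
  exact Submodule.mem_iSup_of_mem (i + j) h1

end IsLefschetzTriple

end Triple

/-! ### §4 Jordan–Lefschetz pairs and Proposition (2.2) -/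

section Jordan

variable (K : Type*) {L : Type*} [CommRing K] [LieRing L] [LieAlgebra K L]

/-- **A Jordan–Lefschetz pair `(𝔤, h)`**: "a Lefschetz pair `(𝔤, h)` is a Jordan–Lefschetz pair if `(𝔤, h, 𝔤₂)` is a
Lefschetz triple" (here: `(L, h, 𝔤₂)` is a Lefschetz triple; it is then a Lefschetz pair, `isLefschetzPair`).
[cite: LooijengaLunts1997, §2 p. 9 L109–L111] -/
def IsJordanLefschetzPair (h : L) : Prop := IsLefschetzTriple K h (adDegree K h 2)

variable {K} {h : L}

namespace IsJordanLefschetzPair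

/-- A Jordan–Lefschetz pair is a Lefschetz pair. [cite: LooijengaLunts1997, §2 p. 9 L109–L110] -/
theorem isLefschetzPair (J : IsJordanLefschetzPair K h) : IsLefschetzPair K h :=
  IsLefschetzTriple.isLefschetzPair J

/-- The underlying Lefschetz triple `(𝔤, h, 𝔤₂)`. [cite: LooijengaLunts1997, §2 p. 9 L109–L110] -/
theorem isLefschetzTriple (J : IsJordanLefschetzPair K h) : IsLefschetzTriple K h (adDegree K h 2) := J

/-- **"It is clear that such a Lefschetz triple is saturated"**: `𝔞 = 𝔤₂` is maximal (any `𝔞' ⊇ 𝔤₂` of a Lefschetz triple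
lies in `𝔤₂`). [cite: LooijengaLunts1997, §2 p. 9 L110–L111] -/
theorem isSaturated (J : IsJordanLefschetzPair K h) : IsLefschetzTriple.IsSaturated K J :=
  fun _ hle T' ↦ le_antisymm T'.le_adDegree_two hle

/-- `𝔤₂` is abelian: "If `e ∈ 𝔤₂` is a Lefschetz element, then `[e, 𝔤₂] = 0`" (indeed `[𝔤₂, 𝔤₂] = 0`).
[cite: LooijengaLunts1997, §2 proof of (2.2) p. 9 L117–L118] -/
theorem lie_eq_zero_of_mem_adDegree_two (J : IsJordanLefschetzPair K h) {x y : L} (hx : x ∈ adDegree K h 2)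
    (hy : y ∈ adDegree K h 2) : ⁅x, y⁆ = 0 :=
  J.lie_eq_zero x hx y hy

/-- Step (a) of (2.2): `Σ_{k ≤ 1} 𝔤_{2k}` is bracket-closed (the only bracket that could leave it, `[𝔤₂, 𝔤₂]`, is `0`),
so it is all of `𝔤`. [cite: LooijengaLunts1997, §2 proof of (2.2) p. 9] -/
theorem iSup_adDegree_le_one_eq_top (J : IsJordanLefschetzPair K h) :
    ⨆ k : {k : ℤ // k ≤ 1}, adDegree K h (2 * ((k : ℤ) : K)) = ⊤ := by
  refine eq_top_iff.2 fun x _ ↦ ?_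
  have hx : x ∈ LieSubalgebra.lieSpan K L ((adDegree K h 2 : Set L) ∪ lefschetzDuals K h (adDegree K h 2)) := by
    rw [J.lieSpan_eq_top]; exact LieSubalgebra.mem_top x
  refine lieSpan_le_iSup_adDegree (fun i j x hx y hy ↦ ?_) ?_ hx
  · by_cases hij : (i : ℤ) = 1 ∧ (j : ℤ) = 1
    · rw [hij.1, Int.cast_one, mul_one] at hx
      rw [hij.2, Int.cast_one, mul_one] at hy
      rw [J.lie_eq_zero_of_mem_adDegree_two hx hy]
      exact Submodule.zero_mem _
    · have hle : (i : ℤ) + j ≤ 1 := by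
        rcases not_and_or.1 hij with hi | hj
        · have := lt_of_le_of_ne i.2 hi; have := j.2; omega
        · have := lt_of_le_of_ne j.2 hj; have := i.2; omega
      have h1 := lie_mem_adDegree hx hy
      rw [← mul_add, ← Int.cast_add] at h1
      exact Submodule.mem_iSup_of_mem (⟨(i : ℤ) + j, hle⟩ : {k : ℤ // k ≤ 1}) h1
  · rintro y (hy | hy)
    · exact Submodule.mem_iSup_of_mem (⟨1, le_rfl⟩ : {k : ℤ // k ≤ 1}) (by
        show y ∈ adDegree K h (2 * ((1 : ℤ) : K)); rw [Int.cast_one, mul_one]; exact hy)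
    · exact Submodule.mem_iSup_of_mem (⟨-1, by omega⟩ : {k : ℤ // k ≤ 1}) (by
        show y ∈ adDegree K h (2 * ((-1 : ℤ) : K))
        rw [Int.cast_neg, Int.cast_one, mul_neg, mul_one]; exact lefschetzDuals_subset_adDegree hy)

end IsJordanLefschetzPair

end Jordan

section JordanField

variable {K : Type*} {L : Type*} [Field K] [CharZero K] [LieRing L] [LieAlgebra K L] {h : L}

namespace IsJordanLefschetzPair

omit [CharZero K] in
/-- Step (a), consequence: a degree not of the form `2k`, `k ≤ 1`, vanishes. [cite: LooijengaLunts1997, §2 (2.2) p. 9] -/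
theorem adDegree_eq_bot_of_forall_ne (J : IsJordanLefschetzPair K h) {c : K} (hc : ∀ k : ℤ, k ≤ 1 → (2 * k : K) ≠ c) :
    adDegree K h c = ⊥ :=
  adDegree_eq_bot_of_iSup_eq_top h J.iSup_adDegree_le_one_eq_top fun k ↦ hc k k.2

variable [FiniteDimensional K L]

/-- Pushing a non-zero vector of degree `c` down by `ad f` (`f ∈ 𝔤₋₂`) reaches a non-zero vector killed by `ad f`: the
iterates have the distinct degrees `c - 2n` and `𝔤` is finite-dimensional. [cite: LooijengaLunts1997, §2 proof of (2.2) ("the primitive decomposition")] -/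
theorem exists_iterate_ne_zero_and_lie_eq_zero {f x : L} (hf : f ∈ adDegree K h (-2)) {c : K}
    (hx : x ∈ adDegree K h c) (hx0 : x ≠ 0) :
    ∃ n : ℕ, ((LieAlgebra.ad K L f) ^ n) x ≠ 0 ∧ ((LieAlgebra.ad K L f) ^ (n + 1)) x = 0 := by
  have h_exists_zero : ∃ n : ℕ, ((LieAlgebra.ad K L f) ^ n) x = 0 := by
    by_contra! contra
    have h_inj : Function.Injective (fun n : ℕ ↦ c + n * (-2 : K)) := by
      intro a b hab
      have h2 : (-2 : K) ≠ 0 := by norm_num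
      have hab' : (a : K) * (-2) = (b : K) * (-2) := add_left_cancel (by simpa only using hab)
      exact_mod_cast mul_right_cancel₀ h2 hab'
    have hli := Module.End.eigenvectors_linearIndependent' (LieAlgebra.ad K L h) _ h_inj
      (fun n ↦ ((LieAlgebra.ad K L f) ^ n) x) fun n ↦ ⟨iterate_mem_adDegree hf n hx, contra n⟩
    haveI : Finite ℕ := hli.finite
    exact not_finite ℕ
  obtain ⟨n, hn, hn'⟩ := Nat.exists_not_and_succ_of_not_zero_of_exists (by simpa using hx0) h_exists_zero
  exact ⟨n, hn, hn'⟩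

/-- Step (b) of (2.2): **no degree `2k` with `k ≤ -2` occurs.**  A non-zero `x ∈ 𝔤_{2k}` would push down by `ad f` to a
lowest-weight vector of weight `-m ≤ -4`, a primitive vector of weight `m` for the opposite triple `(f, -h, e)`, whence
`(ad e)^m` of it is non-zero of degree `m ≥ 4` — excluded by step (a). [cite: LooijengaLunts1997, §2 (2.2) p. 9 L113–L119] -/
theorem adDegree_two_mul_eq_bot_of_le (J : IsJordanLefschetzPair K h) {k : ℤ} (hk : k ≤ -2) :
    adDegree K h (2 * (k : K)) = ⊥ := by
  rw [Submodule.eq_bot_iff]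
  intro x hx
  by_contra hx0
  obtain ⟨e, ⟨he, f, t⟩⟩ := J.nonempty_lefschetzDomain
  have hf : f ∈ adDegree K h (-2) := (f_mem_adDegree t)
  obtain ⟨n, hn, hn'⟩ := exists_iterate_ne_zero_and_lie_eq_zero hf hx hx0
  set y : L := ((LieAlgebra.ad K L f) ^ n) x with hy_def
  have hy : y ∈ adDegree K h (2 * (k : K) + n * (-2 : K)) := iterate_mem_adDegree hf n hx
  -- the weight of `y` for `-h` is the natural number `m = 2n - 2k ≥ 4`
  obtain ⟨m, hm⟩ : ∃ m : ℕ, (m : ℤ) = 2 * (n : ℤ) - 2 * k :=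
    ⟨(2 * (n : ℤ) - 2 * k).toNat, Int.toNat_of_nonneg (by omega)⟩
  have hm4 : 4 ≤ m := by omega
  have hμ : -(2 * (k : K) + n * (-2 : K)) = (m : K) := by
    have : ((m : ℤ) : K) = ((2 * n - 2 * k : ℤ) : K) := by rw [hm]
    push_cast at this
    rw [this]; ring
  have P : (t.symm).HasPrimitiveVectorWith y (m : K) :=
    { ne_zero := hn
      lie_h := by rw [neg_lie, (mem_adDegree_iff.1 hy), ← neg_smul, hμ]
      lie_e := by
        rw [hy_def, ← LieAlgebra.ad_apply K L, ← Module.End.mul_apply, ← pow_succ']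
        exact hn' }
  have hz := P.pow_toEnd_f_ne_zero_of_eq_nat rfl le_rfl
  -- `(ad e)^m y` has degree `-m + 2m = m ≥ 4`, a degree excluded by step (a)
  have hz' : ((LieModule.toEnd K L L e) ^ m) y ∈ adDegree K h ((m : ℕ) : K) := by
    have h1 := iterate_mem_adDegree (e_mem_adDegree (K := K) t) m hy
    have h2 : 2 * (k : K) + n * (-2 : K) + m * 2 = (m : K) := by
      rw [← neg_neg (2 * (k : K) + n * (-2 : K)), hμ]; ring
    rw [h2] at h1
    exact h1
  have hbot : adDegree K h ((m : ℕ) : K) = ⊥ := by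
    refine J.adDegree_eq_bot_of_forall_ne fun k' hk' habs ↦ ?_
    have : (2 * k' : ℤ) = m := by exact_mod_cast habs
    omega
  rw [hbot, Submodule.mem_bot] at hz'
  exact hz hz'

/-- **(2.2) Proposition, first assertion, vanishing form: `𝔤_c = 0` for every `c ∉ {-2, 0, 2}`** (Jordan–Lefschetz pair,
`𝔤` finite-dimensional over a field of characteristic `0`). [cite: LooijengaLunts1997, §2 (2.2) p. 9 L113–L119 ("𝔤 = 𝔤₋₂ ⊕ 𝔤₀ ⊕ 𝔤₂")] -/
theorem adDegree_eq_bot (J : IsJordanLefschetzPair K h) {c : K} (hc₁ : c ≠ -2) (hc₂ : c ≠ 0) (hc₃ : c ≠ 2) :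
    adDegree K h c = ⊥ := by
  by_cases hck : ∃ k : ℤ, k ≤ 1 ∧ (2 * k : K) = c
  · obtain ⟨k, hk1, rfl⟩ := hck
    have hk : k ≤ -2 := by
      rcases lt_or_ge k (-1) with hlt | hge
      · omega
      · exfalso
        interval_cases k
        · exact hc₁ (by norm_num)
        · exact hc₂ (by norm_num)
        · exact hc₃ (by norm_num)
    exact J.adDegree_two_mul_eq_bot_of_le hk
  · push Not at hck
    exact J.adDegree_eq_bot_of_forall_ne fun k hk ↦ hck k hk

/-- **(2.2) Proposition, first assertion: `𝔤 = 𝔤₋₂ ⊕ 𝔤₀ ⊕ 𝔤₂`** for a Jordan–Lefschetz pair (`𝔤` finite-dimensional over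
a field of characteristic `0`) — the three degrees span `𝔤`; they are independent by `disjoint_adDegree` /
`disjoint_sup_adDegree`. [cite: LooijengaLunts1997, §2 (2.2) p. 9 L113–L119] -/
theorem sup_adDegree_eq_top (J : IsJordanLefschetzPair K h) :
    adDegree K h (-2) ⊔ adDegree K h 0 ⊔ adDegree K h 2 = ⊤ := by
  rw [eq_top_iff, ← J.iSup_adDegree_le_one_eq_top]
  refine iSup_le fun k ↦ ?_
  obtain ⟨k, hk⟩ := k
  show adDegree K h (2 * ((k : ℤ) : K)) ≤ _
  rcases lt_or_ge k (-1) with hlt | hge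
  · rw [J.adDegree_two_mul_eq_bot_of_le (by omega)]
    exact bot_le
  · have hk' : k = -1 ∨ k = 0 ∨ k = 1 := by omega
    rcases hk' with rfl | rfl | rfl
    · rw [show (2 * ((-1 : ℤ) : K)) = -2 by norm_num]
      exact le_sup_left.trans le_sup_left
    · rw [show (2 * ((0 : ℤ) : K)) = 0 by norm_num]
      exact le_sup_right.trans le_sup_left
    · rw [show (2 * ((1 : ℤ) : K)) = 2 by norm_num]
      exact le_sup_right

/-- Every `x ∈ 𝔤` splits as `x = x₋₂ + x₀ + x₂` with `x_c ∈ 𝔤_c`. [cite: LooijengaLunts1997, §2 (2.2) p. 9] -/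
theorem exists_eq_add (J : IsJordanLefschetzPair K h) (x : L) :
    ∃ u ∈ adDegree K h (-2), ∃ v ∈ adDegree K h 0, ∃ w ∈ adDegree K h 2, x = u + v + w := by
  have hx : x ∈ adDegree K h (-2) ⊔ adDegree K h 0 ⊔ adDegree K h 2 := by
    rw [J.sup_adDegree_eq_top]; exact Submodule.mem_top
  obtain ⟨uv, huv, w, hw, rfl⟩ := Submodule.mem_sup.1 hx
  obtain ⟨u, hu, v, hv, rfl⟩ := Submodule.mem_sup.1 huv
  exact ⟨u, hu, v, hv, w, hw, rfl⟩

/-- **(2.1) (i) ⇒ (ii) for a Jordan–Lefschetz pair: `𝔤₋₂` is abelian** (`[𝔤₋₂, 𝔤₋₂] ⊆ 𝔤₋₄ = 0`). [cite: LooijengaLunts1997, §2 (2.1) p. 9 L83–L94 ("We only prove the nontrivial implication (ii) ⇒ (i)")] -/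
theorem lie_eq_zero_of_mem_adDegree_neg_two (J : IsJordanLefschetzPair K h) {x y : L} (hx : x ∈ adDegree K h (-2))
    (hy : y ∈ adDegree K h (-2)) : ⁅x, y⁆ = 0 := by
  have h1 := lie_mem_adDegree hx hy
  rw [J.adDegree_eq_bot (by norm_num) (by norm_num) (by norm_num), Submodule.mem_bot] at h1
  exact h1

/-- **(2.1) (i) ⇒ (ii): "the operators `f_a` with `a ∈ 𝔞` in the domain of `f`, mutually commute"** for a Jordan–Lefschetz
pair. [cite: LooijengaLunts1997, §2 (2.1) p. 9 L91–L92] -/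
theorem lie_eq_zero_of_mem_lefschetzDuals (J : IsJordanLefschetzPair K h) {f f' : L}
    (hf : f ∈ lefschetzDuals K h (adDegree K h 2)) (hf' : f' ∈ lefschetzDuals K h (adDegree K h 2)) : ⁅f, f'⁆ = 0 :=
  J.lie_eq_zero_of_mem_adDegree_neg_two (lefschetzDuals_subset_adDegree hf) (lefschetzDuals_subset_adDegree hf')

end IsJordanLefschetzPair

end JordanField

/-! ### §5 Validation: `𝔰𝔩₂` is a Jordan–Lefschetz pair with `𝔤₂ = K e` -/

section Sl2

variable {K : Type*} {L : Type*} [Field K] [CharZero K] [LieRing L] [LieAlgebra K L] {h e f : L}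

/-- In `𝔰𝔩₂ = K h + K e + K f`, the degree-`2` part is the line `K e` (the components `a h ∈ 𝔤₀`, `c f ∈ 𝔤₋₂` of an
element of `𝔤₂` vanish, the three degrees being independent). [cite: LooijengaLunts1997, §2 (2.6) (case (A₁, ∅), m = 1), (2.9)] -/
theorem mem_adDegree_two_iff_of_isSl2Triple (t : IsSl2Triple h e f)
    (hspan : ∀ x : L, ∃ a b c : K, x = a • h + b • e + c • f) {x : L} :
    x ∈ adDegree K h 2 ↔ ∃ b : K, x = b • e := by
  refine ⟨fun hx ↦ ?_, ?_⟩
  · obtain ⟨a, b, c, rfl⟩ := hspan x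
    refine ⟨b, ?_⟩
    have h1 : a • h + c • f ∈ adDegree K h (-2) ⊔ adDegree K h 0 :=
      Submodule.add_mem _ (Submodule.mem_sup_right (Submodule.smul_mem _ _ (self_mem_adDegree_zero h)))
        (Submodule.mem_sup_left (Submodule.smul_mem _ _ (f_mem_adDegree t)))
    have h2 : a • h + c • f ∈ adDegree K h 2 := by
      have h3 : a • h + c • f = (a • h + b • e + c • f) - b • e := by abel
      rw [h3]
      exact Submodule.sub_mem _ hx (Submodule.smul_mem _ _ (e_mem_adDegree t))
    have h0 : a • h + c • f = 0 := (Submodule.disjoint_def.1 (disjoint_sup_adDegree h)) _ h1 h2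
    calc a • h + b • e + c • f = b • e + (a • h + c • f) := by abel
      _ = b • e := by rw [h0, add_zero]
  · rintro ⟨b, rfl⟩
    exact Submodule.smul_mem _ _ (e_mem_adDegree t)

/-- **VALIDATION — `𝔰𝔩₂` IS A JORDAN–LEFSCHETZ PAIR**: if the semisimple Lie algebra `L` is spanned by an `𝔰𝔩₂`-triple
`(e, h, f)`, then `(L, h)` is a Jordan–Lefschetz pair: `𝔤₂ = K e` is abelian, `e` lies in the domain of `f` (partner `f`),
and `e`, `f` generate `L` (`h = [e, f]`) — the smallest case `(A₁, ∅)` (`m = 1` of `(A_{2m-1}, A_{m-1} + A_{m-1})`) of the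
classification (2.6). [cite: LooijengaLunts1997, §1 (1.1) p. 4 ("the assignment … defines a representation of 𝔰𝔩(2)"), §2 (2.6)] -/
theorem isJordanLefschetzPair_of_isSl2Triple [LieAlgebra.IsSemisimple K L] (t : IsSl2Triple h e f)
    (hspan : ∀ x : L, ∃ a b c : K, x = a • h + b • e + c • f) : IsJordanLefschetzPair K h := by
  refine ⟨‹_›, le_rfl, fun x hx y hy ↦ ?_, ⟨e, (e_mem_adDegree t), f, t⟩, ?_⟩
  · obtain ⟨b, rfl⟩ := (mem_adDegree_two_iff_of_isSl2Triple t hspan).1 hx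
    obtain ⟨b', rfl⟩ := (mem_adDegree_two_iff_of_isSl2Triple t hspan).1 hy
    rw [smul_lie, lie_smul, lie_self, smul_zero, smul_zero]
  · refine eq_top_iff.2 fun x _ ↦ ?_
    set S := LieSubalgebra.lieSpan K L ((adDegree K h 2 : Set L) ∪ lefschetzDuals K h (adDegree K h 2))
    have he : e ∈ S := LieSubalgebra.subset_lieSpan (Or.inl (e_mem_adDegree t))
    have hf : f ∈ S := LieSubalgebra.subset_lieSpan (Or.inr ⟨e, (e_mem_adDegree t), t⟩)
    have hh : h ∈ S := by
      have h1 := S.lie_mem he hf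
      rwa [t.lie_e_f] at h1
    obtain ⟨a, b, c, rfl⟩ := hspan x
    exact S.add_mem (S.add_mem (S.smul_mem a hh) (S.smul_mem b he)) (S.smul_mem c hf)

omit [CharZero K] in
/-- … and then `𝔤₋₂ = K f`, `𝔤₀ = K h` hold as well: every `x` is `c f + a h + b e` with the three summands in degrees
`-2, 0, 2` (the decomposition `𝔤 = 𝔤₋₂ ⊕ 𝔤₀ ⊕ 𝔤₂` of (2.2) for `𝔰𝔩₂`). [cite: LooijengaLunts1997, §2 (2.2), (2.6)] -/
theorem exists_mem_adDegree_of_isSl2Triple (t : IsSl2Triple h e f)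
    (hspan : ∀ x : L, ∃ a b c : K, x = a • h + b • e + c • f) (x : L) :
    ∃ u ∈ adDegree K h (-2), ∃ v ∈ adDegree K h 0, ∃ w ∈ adDegree K h 2, x = u + v + w := by
  obtain ⟨a, b, c, rfl⟩ := hspan x
  exact ⟨c • f, Submodule.smul_mem _ _ (f_mem_adDegree t), a • h, Submodule.smul_mem _ _ (self_mem_adDegree_zero h),
    b • e, Submodule.smul_mem _ _ (e_mem_adDegree t), by abel⟩

end Sl2

/-! ### §6 `𝔰𝔩₂` continued: `𝔤₀ = K h`, `𝔤₋₂ = K f`, all other degrees vanish, `dim = 3`, and the converse in dimension `3` -/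

section Sl2Basis

variable {K : Type*} {L : Type*} [Field K] [CharZero K] [LieRing L] [LieAlgebra K L] {h e f : L}

variable (K) in
/-- `h, e, f` are linearly independent — non-zero eigenvectors of `ad h` for the distinct eigenvalues `0, 2, -2`
(characteristic `0`).  Private helper: the tree's public statement is
`Literature.Geometry.Kaehler.Sl2Triple.linearIndependent_triple : LinearIndependent K ![e, f, h]` (in
`Geometry/Kaehler/ComplexTorusNeronSeveriLieAlgebraPicardOne`, a geometry-layer file this algebra-layer file does not
import); it only serves `finrank_eq_three_of_isSl2Triple` / `exists_eq_smul_add_of_isSl2Triple` below.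
[cite: LooijengaLunts1997, §1 (1.1) p. 4 ("(e, h, f) is a 𝔰𝔩(2)-triple")] [folklore] -/
private theorem linearIndependent_hef (t : IsSl2Triple h e f) : LinearIndependent K ![h, e, f] := by
  refine Module.End.eigenvectors_linearIndependent' (LieAlgebra.ad K L h) ![(0 : K), 2, -2] ?_ _ ?_
  · intro i j hij
    fin_cases i <;> fin_cases j <;> first | rfl | norm_num at hij
  · intro i
    fin_cases i
    · exact ⟨self_mem_adDegree_zero h, t.h_ne_zero⟩
    · exact ⟨e_mem_adDegree t, t.e_ne_zero⟩
    · exact ⟨f_mem_adDegree t, t.f_ne_zero⟩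

/-- In `𝔰𝔩₂ = K h + K e + K f` the degree-`0` part is the line `K h` (the components `b e ∈ 𝔤₂`, `c f ∈ 𝔤₋₂` of an
element of `𝔤₀` vanish). [cite: LooijengaLunts1997, §2 (2.2), (2.6) (case (A₁, ∅))] -/
theorem mem_adDegree_zero_iff_of_isSl2Triple (t : IsSl2Triple h e f)
    (hspan : ∀ x : L, ∃ a b c : K, x = a • h + b • e + c • f) {x : L} :
    x ∈ adDegree K h 0 ↔ ∃ a : K, x = a • h := by
  refine ⟨fun hx ↦ ?_, ?_⟩
  · obtain ⟨a, b, c, rfl⟩ := hspan x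
    refine ⟨a, ?_⟩
    have h1 : b • e + c • f ∈ ⨆ i, adDegree K h (![(2 : K), -2] i) :=
      Submodule.add_mem _ (Submodule.mem_iSup_of_mem (0 : Fin 2) (Submodule.smul_mem _ _ (e_mem_adDegree t)))
        (Submodule.mem_iSup_of_mem (1 : Fin 2) (Submodule.smul_mem _ _ (f_mem_adDegree t)))
    have h2 : b • e + c • f ∈ adDegree K h 0 := by
      have h3 : b • e + c • f = (a • h + b • e + c • f) - a • h := by abel
      rw [h3]
      exact Submodule.sub_mem _ hx (Submodule.smul_mem _ _ (self_mem_adDegree_zero h))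
    have h0 : b • e + c • f = 0 :=
      (Submodule.disjoint_def.1 (disjoint_adDegree_iSup h (d := ![(2 : K), -2]) (c := 0)
        (fun i ↦ by fin_cases i <;> norm_num))) _ h2 h1
    calc a • h + b • e + c • f = a • h + (b • e + c • f) := by abel
      _ = a • h := by rw [h0, add_zero]
  · rintro ⟨a, rfl⟩
    exact Submodule.smul_mem _ _ (self_mem_adDegree_zero h)

/-- … and the degree-`-2` part is the line `K f`. [cite: LooijengaLunts1997, §2 (2.2), (2.6) (case (A₁, ∅))] -/
theorem mem_adDegree_neg_two_iff_of_isSl2Triple (t : IsSl2Triple h e f)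
    (hspan : ∀ x : L, ∃ a b c : K, x = a • h + b • e + c • f) {x : L} :
    x ∈ adDegree K h (-2) ↔ ∃ c : K, x = c • f := by
  refine ⟨fun hx ↦ ?_, ?_⟩
  · obtain ⟨a, b, c, rfl⟩ := hspan x
    refine ⟨c, ?_⟩
    have h1 : a • h + b • e ∈ ⨆ i, adDegree K h (![(0 : K), 2] i) :=
      Submodule.add_mem _ (Submodule.mem_iSup_of_mem (0 : Fin 2) (Submodule.smul_mem _ _ (self_mem_adDegree_zero h)))
        (Submodule.mem_iSup_of_mem (1 : Fin 2) (Submodule.smul_mem _ _ (e_mem_adDegree t)))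
    have h2 : a • h + b • e ∈ adDegree K h (-2) := by
      have h3 : a • h + b • e = (a • h + b • e + c • f) - c • f := by abel
      rw [h3]
      exact Submodule.sub_mem _ hx (Submodule.smul_mem _ _ (f_mem_adDegree t))
    have h0 : a • h + b • e = 0 :=
      (Submodule.disjoint_def.1 (disjoint_adDegree_iSup h (d := ![(0 : K), 2]) (c := -2)
        (fun i ↦ by fin_cases i <;> norm_num))) _ h2 h1
    calc a • h + b • e + c • f = c • f + (a • h + b • e) := by abel
      _ = c • f := by rw [h0, add_zero]
  · rintro ⟨c, rfl⟩
    exact Submodule.smul_mem _ _ (f_mem_adDegree t)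

omit [CharZero K] in
/-- `𝔰𝔩₂ = 𝔤₋₂ + 𝔤₀ + 𝔤₂` as a supremum of the three degrees. [cite: LooijengaLunts1997, §2 (2.2)] -/
theorem iSup_adDegree_eq_top_of_isSl2Triple (t : IsSl2Triple h e f)
    (hspan : ∀ x : L, ∃ a b c : K, x = a • h + b • e + c • f) :
    ⨆ i, adDegree K h (![(-2 : K), 0, 2] i) = ⊤ := by
  refine eq_top_iff.2 fun x _ ↦ ?_
  obtain ⟨a, b, c, rfl⟩ := hspan x
  exact Submodule.add_mem _ (Submodule.add_mem _
    (Submodule.mem_iSup_of_mem (1 : Fin 3) (Submodule.smul_mem _ _ (self_mem_adDegree_zero h)))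
    (Submodule.mem_iSup_of_mem (2 : Fin 3) (Submodule.smul_mem _ _ (e_mem_adDegree t))))
    (Submodule.mem_iSup_of_mem (0 : Fin 3) (Submodule.smul_mem _ _ (f_mem_adDegree t)))

omit [CharZero K] in
/-- … so every OTHER degree of `𝔰𝔩₂` vanishes: `𝔤_c = 0` for `c ∉ {-2, 0, 2}` (here from the spanning alone — no
semisimplicity, no characteristic hypothesis). [cite: LooijengaLunts1997, §2 (2.2), (2.6) (case (A₁, ∅))] -/
theorem adDegree_eq_bot_of_isSl2Triple (t : IsSl2Triple h e f)
    (hspan : ∀ x : L, ∃ a b c : K, x = a • h + b • e + c • f) {c : K} (hc₁ : c ≠ -2) (hc₂ : c ≠ 0) (hc₃ : c ≠ 2) :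
    adDegree K h c = ⊥ :=
  adDegree_eq_bot_of_iSup_eq_top h (iSup_adDegree_eq_top_of_isSl2Triple t hspan)
    (fun i ↦ by fin_cases i <;> simp [hc₁.symm, hc₂.symm, hc₃.symm])

/-- **`dim 𝔰𝔩₂ = 3`: `(h, e, f)` is a basis of a Lie algebra spanned by an `𝔰𝔩₂`-triple.** [cite: LooijengaLunts1997, §1 (1.1), §2 (2.6)] -/
theorem finrank_eq_three_of_isSl2Triple (t : IsSl2Triple h e f)
    (hspan : ∀ x : L, ∃ a b c : K, x = a • h + b • e + c • f) : Module.finrank K L = 3 := by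
  have htop : Submodule.span K (Set.range ![h, e, f]) = ⊤ := by
    refine eq_top_iff.2 fun x _ ↦ ?_
    obtain ⟨a, b, c, rfl⟩ := hspan x
    exact Submodule.add_mem _ (Submodule.add_mem _ (Submodule.smul_mem _ _ (Submodule.subset_span ⟨0, rfl⟩))
      (Submodule.smul_mem _ _ (Submodule.subset_span ⟨1, rfl⟩))) (Submodule.smul_mem _ _ (Submodule.subset_span ⟨2, rfl⟩))
  have h1 := finrank_span_eq_card (linearIndependent_hef K t)
  rw [htop, finrank_top, Fintype.card_fin] at h1
  exact h1

/-- Conversely, **in dimension `3` an `𝔰𝔩₂`-triple spans**: every `x` is `a h + b e + c f`. [cite: LooijengaLunts1997, §1 (1.1), §2 (2.6)] -/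
theorem exists_eq_smul_add_of_isSl2Triple (t : IsSl2Triple h e f) (h3 : Module.finrank K L = 3) (x : L) :
    ∃ a b c : K, x = a • h + b • e + c • f := by
  have htop := (linearIndependent_hef K t).span_eq_top_of_card_eq_finrank (by rw [Fintype.card_fin, h3])
  have hx : x ∈ Submodule.span K (Set.range ![h, e, f]) := by
    rw [htop]
    exact Submodule.mem_top
  obtain ⟨c, hc⟩ := (Submodule.mem_span_range_iff_exists_fun K).1 hx
  exact ⟨c 0, c 1, c 2, by rw [← hc, Fin.sum_univ_three]; rfl⟩

/-- Hence **a semisimple `3`-dimensional Lie algebra with an `𝔰𝔩₂`-triple `(e, h, f)` is a Jordan–Lefschetz pair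
`(L, h)`** (the case `(A₁, ∅)` of (2.6)). [cite: LooijengaLunts1997, §1 p. 7, §2 (2.6)] -/
theorem isJordanLefschetzPair_of_isSl2Triple_of_finrank_eq_three [LieAlgebra.IsSemisimple K L] (t : IsSl2Triple h e f)
    (h3 : Module.finrank K L = 3) : IsJordanLefschetzPair K h :=
  isJordanLefschetzPair_of_isSl2Triple t (exists_eq_smul_add_of_isSl2Triple t h3)

end Sl2Basis

end Literature.Algebra.Lie
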